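import Literature.NumberTheory.EllipticCurves.ModularSymbolsManin
import Literature.NumberTheory.EllipticCurves.ModularCurveGenusBoundProofs
import Literature.NumberTheory.EllipticCurves.PAdicLFunctionDistributionProofs
import HarnessLib

/-!
# `Ω^±_f > 0` for rational newforms from the dimension formula `dim S₂(Γ₀(N)) = g(X₀(N))`
  (glue of `ModularSymbolsManin` and `PAdicLFunctionDistributionProofs`; trunk EllArithM)

The named facts `IsNewform0.plusPeriod_pos`, `IsNewform0.minusPeriod_pos` of `ModularSymbols`
(`Ω^±_f > 0` for a newform `f ∈ S₂(Γ₀(N))` with rational coefficients; Cremona 1997, §2.8: "`Ω(f)`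
is twice the least real part of a period of `f`") and the Eichler–Shimura lattice property
`isZLattice_periodLattice` are reduced in `ModularSymbolsManin`
(`IsNewform0.plusPeriod_pos_of_genus`, `isZLattice_periodLattice_of_genus`) to

1. the genus-cum-dimension formula `12 dim S₂(Γ₀(N)) + 3ε₂ + 4ε₃ + 6ε_∞ = 12 + μ`
   (`twelve_mul_finrank_cuspForm_two (Gamma0 N)` of `ModularCurveProofs`; Diamond–Shurman
   Thm. 3.1.1 with Thm. 3.5.1 — Riemann–Roch on `X₀(N)`; its `≤` half is proved there,
   `twelve_mul_finrank_cuspForm_two_add_le`), and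
2. the conjugation-stability `Λ̄_f = Λ_f` (`conj_mem_periodLattice` of `ModularSymbols`),

everything else — Manin's presentation and rank bound, the Hecke action on the period homology,
`T_p f = a_p f` and multiplicity one for simultaneous `T_p`-eigenforms (`NewformsHeckeProofs`), the
rank count `dim_ℚ ℚΛ_f ≤ 2`, the spanning `ℝΛ_f = ℂ`, and the lattice step `re Λ_f = ℤ(Ω⁺/2)` —
being proved. Item 2 is proved in `PAdicLFunctionDistributionProofs`
(`conj_mem_periodLattice_holds`), which the modular-symbol files do not import (it carries the
`p`-adic `L`-function closure and itself consumes `isZLattice_periodLattice` as a hypothesis); this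
file only combines the two, leaving `Ω^±_f > 0` conditional on item 1 exactly:
`IsNewform0.plusPeriod_pos_of_dimension_formula`. Since the `≤` half of item 1 is proved, what
remains is precisely its `≥` half, the existence of `g(X₀(N))` independent weight-`2` cusp forms
(`twelve_mul_finrank_cuspForm_two_gamma0_iff_le` of `ModularCurveGenusBoundProofs`, in the closed
form `12 + μ ≤ 12 dim S₂(Γ₀(N)) + 3ν₂ + 4ν₃ + 6ν_∞`): `IsNewform0.plusPeriod_pos_of_le`,
`IsNewform0.plusPeriod_pos_of_genusX0_le` (`g(X₀(N)) ≤ dim S₂(Γ₀(N))` plus the integrality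
`twelve_mul_genusX0 N` of the genus formula), `IsNewform0.plusPeriod_pos_of_finrank_eq_genusX0`
(the named fact `finrank_cuspForm_two_eq_genusX0 N` of `ModularCurve` plus `twelve_mul_genusX0 N`).

## References

* J. E. Cremona, *Algorithms for modular elliptic curves*, 2nd ed., CUP 1997, §2.6, §2.8, §2.10.
* F. Diamond, J. Shurman, *A first course in modular forms*, GTM 228, Springer 2005, Thm. 3.1.1,
  Thm. 3.5.1, §6.1, §6.6.
-/

noncomputable section

open scoped MatrixGroups ModularForm

open CongruenceSubgroup

namespace Literature.NumberTheory.EllipticCurves.ModularForms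

variable {N : ℕ} [NeZero N]

/-- **`Ω⁺_f > 0` for a rational newform `f ∈ S₂(Γ₀(N))`** (the named fact
`IsNewform0.plusPeriod_pos` of `ModularSymbols`) **from the dimension formula
`12 dim S₂(Γ₀(N)) + 3ε₂ + 4ε₃ + 6ε_∞ = 12 + μ` alone** (`twelve_mul_finrank_cuspForm_two (Gamma0 N)`,
Riemann–Roch on `X₀(N)`): the conjugation-stability input of `IsNewform0.plusPeriod_pos_of_genus`
(`ModularSymbolsManin`) is discharged by `conj_mem_periodLattice_holds`
(`PAdicLFunctionDistributionProofs`) (Cremona 1997, §2.8: "`Ω(f)` is twice the least real part of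
a period of `f`"). [cite: CremonaAlgorithms1997, §2.8] -/
theorem IsNewform0.plusPeriod_pos_of_dimension_formula
    (h₁ : twelve_mul_finrank_cuspForm_two (Gamma0 N)) {f : CuspForm (Gamma0 N) 2} :
    IsNewform0.plusPeriod_pos (f := f) :=
  IsNewform0.plusPeriod_pos_of_genus h₁ (conj_mem_periodLattice_holds (f := f))

/-- **`Ω⁻_f > 0` for a rational newform `f`** (the named fact `IsNewform0.minusPeriod_pos`) from the
dimension formula alone (Cremona 1997, §2.8). [cite: CremonaAlgorithms1997, §2.8] -/
theorem IsNewform0.minusPeriod_pos_of_dimension_formula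
    (h₁ : twelve_mul_finrank_cuspForm_two (Gamma0 N)) {f : CuspForm (Gamma0 N) 2} :
    IsNewform0.minusPeriod_pos (f := f) :=
  IsNewform0.minusPeriod_pos_of_genus h₁ (conj_mem_periodLattice_holds (f := f))

/-- **`Ω⁺_f > 0` from the lattice property of the period homology** (`periodHomology_eq_span_basis`,
Eichler–Shimura for `X₀(N)`) alone, without the conjugation hypothesis of
`IsNewform0.plusPeriod_pos_of_periodHomology` (`ModularSymbolsPeriodHomology`). [cite: CremonaAlgorithms1997, §2.8] -/
theorem IsNewform0.plusPeriod_pos_of_periodHomology_eq_span_basis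
    (hES : periodHomology_eq_span_basis N) {f : CuspForm (Gamma0 N) 2} :
    IsNewform0.plusPeriod_pos (f := f) :=
  IsNewform0.plusPeriod_pos_of_periodHomology hES (conj_mem_periodLattice_holds (f := f))

/-- **`Ω⁺_f > 0` from the Eichler–Shimura lattice property of `Λ_f` alone**
(`isZLattice_periodLattice`, the hypothesis `hES` of `PAdicLFunctionDistributionProofs`), the
conjugation input of `IsNewform0.plusPeriod_pos_of` (`ModularSymbols`) being discharged. [cite: CremonaAlgorithms1997, §2.8] -/
theorem IsNewform0.plusPeriod_pos_of_isZLattice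
    {f : CuspForm (Gamma0 N) 2} (hES : isZLattice_periodLattice (f := f)) :
    IsNewform0.plusPeriod_pos (f := f) :=
  IsNewform0.plusPeriod_pos_of hES (conj_mem_periodLattice_holds (f := f))

/-! ### What exactly remains: the existence half `dim S₂(Γ₀(N)) ≥ g(X₀(N))` -/

/-- **`Ω⁺_f > 0` for a rational newform `f ∈ S₂(Γ₀(N))` from the existence half of the dimension
formula alone**, in closed form: `12 + μ ≤ 12 dim S₂(Γ₀(N)) + 3ν₂ + 4ν₃ + 6ν_∞`
(`μ = gamma0Index N`, `ν₂, ν₃, ν_∞` the classical counts of `ModularCurve`; i.e.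
`dim S₂(Γ₀(N)) ≥ g(X₀(N))`, Riemann–Roch, Diamond–Shurman Thm. 3.5.1) implies the named fact
`IsNewform0.plusPeriod_pos` — the `≤` half being Manin's bound
(`twelve_mul_finrank_cuspForm_two_gamma0_iff_le` of `ModularCurveGenusBoundProofs`)
(Cremona 1997, §2.8). [cite: CremonaAlgorithms1997, §2.8] -/
theorem IsNewform0.plusPeriod_pos_of_le
    (hge : 12 + gamma0Index N ≤
      12 * Module.finrank ℂ (CuspForm (Gamma0 N) 2) + 3 * nu₂ N + 4 * nu₃ N + 6 * nuInfty N)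
    {f : CuspForm (Gamma0 N) 2} : IsNewform0.plusPeriod_pos (f := f) :=
  IsNewform0.plusPeriod_pos_of_dimension_formula
    ((twelve_mul_finrank_cuspForm_two_gamma0_iff_le N).mpr hge)

/-- **`Ω⁺_f > 0` from `g(X₀(N)) ≤ dim S₂(Γ₀(N))`** (the existence of `g(X₀(N))` linearly
independent weight-`2` cusp forms on `Γ₀(N)`, Riemann–Roch; Diamond–Shurman Thm. 3.5.1) **and the
integrality of the genus formula** `12 g(X₀(N)) + 3ν₂ + 4ν₃ + 6ν_∞ = 12 + μ` (`twelve_mul_genusX0 N`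
of `ModularCurve`, `genusX0 N` being defined by the rounded-down classical formula)
(Cremona 1997, §2.8). [cite: CremonaAlgorithms1997, §2.8] -/
theorem IsNewform0.plusPeriod_pos_of_genusX0_le (hg : twelve_mul_genusX0 N)
    (h : genusX0 N ≤ Module.finrank ℂ (CuspForm (Gamma0 N) 2)) {f : CuspForm (Gamma0 N) 2} :
    IsNewform0.plusPeriod_pos (f := f) := by
  refine IsNewform0.plusPeriod_pos_of_le (N := N) ?_
  unfold twelve_mul_genusX0 at hg
  omega

/-- **`Ω⁺_f > 0` from the dimension formula `dim S₂(Γ₀(N)) = g(X₀(N))` in closed form** (the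
named fact `finrank_cuspForm_two_eq_genusX0 N` of `ModularCurve`, Diamond–Shurman Thm. 3.5.1) and
the integrality `twelve_mul_genusX0 N` of the genus formula
(`twelve_mul_finrank_cuspForm_two_gamma0_of` of `ModularCurveGenusBoundProofs`)
(Cremona 1997, §2.8). [cite: CremonaAlgorithms1997, §2.8] -/
theorem IsNewform0.plusPeriod_pos_of_finrank_eq_genusX0 (h : finrank_cuspForm_two_eq_genusX0 N)
    (hg : twelve_mul_genusX0 N) {f : CuspForm (Gamma0 N) 2} :
    IsNewform0.plusPeriod_pos (f := f) :=
  IsNewform0.plusPeriod_pos_of_dimension_formula (twelve_mul_finrank_cuspForm_two_gamma0_of N h hg)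

end Literature.NumberTheory.EllipticCurves.ModularForms

end
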